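import Literature.NumberTheory.EllipticCurves.Kato2004.DivisibilityInputsMu
import Literature.NumberTheory.EllipticCurves.KatoFineSelmerDual
import HarnessLib

/-!
# Kato 2004 (Astérisque 295) (14.9.3)/(17.13.1): the cokernel of `P → X(E/ℚ_∞)` is the dual FINE
# Selmer group `X₀(E/ℚ_∞)` — the `μ`-transfer `μ(X₀) = 0 ⟹ μ(X) = 0` over the package
# `Kato2004.DivisibilityInputs` (theorems) and ONE construction fact pinning that cokernel

Topic `NumberTheory/EllipticCurves`, sub-directory `Kato2004`. Cell `bsd-smallim` (rung K6, class X9),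
seat `bsd-smallim-k6-ty`. Companion of `DivisibilityInputs.lean` / `DivisibilityInputsMu.lean`.

WHY THIS FILE (honest framing). In the package `K : DivisibilityInputs W p f κ γ I D` the modules
`P, 𝐇², 𝐇²_loc` are ABSTRACT (only `𝐇¹ = I.H` and `X = D.X` are pinned), so an obligation phrased as
"`μ(K.H2) = 0`" cannot be discharged by a Galois-cohomological argument about Kato's actual `𝐇²`:
nothing ties `K.H2` to cohomology.  Kato's own sequence repairs this without pinning `𝐇²`: by
(14.9.3) (p. 240, the Poitou–Tate sequence "`0 → H¹(O_K[1/p],T)/H¹_f → H¹(K ⊗ ℚ_p,T)/H¹_f →(a)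
S(K, T*(1))^∨ → H²(O_K[1/p], T) → H²(K ⊗ ℚ_p, T) → {H⁰(O_K[1/p], T*(1) ⊗ ℚ/ℤ)}^∨`, … exact in
the case `p ≠ 2`", with `a` the dual of the localisation `S(K, T*(1)) → H¹_f(K ⊗ ℚ_p, T*(1) ⊗ ℚ/ℤ)`)
and its inverse limit (17.13.1) (p. 279) over `K = ℚ(ζ_{p^n})`, the cokernel of
`P = 𝐇¹_loc/𝐇¹_{loc,f} → 𝔛` is the Pontryagin dual of the Selmer classes over `ℚ_∞` that are
LOCALLY TRIVIAL at the prime above `p` (Selmer classes already land in `H¹_f` there), i.e. — the local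
conditions away from `p` being "locally trivial" over `ℚ_∞` (Kim, AJM 148 §1.2.4: the `p`-strict =
fine Selmer group `Sel₀(ℚ_∞, E[p^∞])`; tree `WeierstrassCurve.fineSelmerInfty`, file
`KatoFineSelmerDual`) — the dual fine Selmer group `X₀(E/ℚ_∞)`, which the tree PINS as
`WeierstrassCurve.FineSelmerDualData W κ γ` (`Y.X ≅ Hom(Sel₀(ℚ_∞, E[p^∞]), ℚ/ℤ)`, `T = γ − 1`).
Hence:

* THEOREMS (kernel, over explicit hypotheses, nothing asserted): for ANY `Λ`-module `Y` and any
  `Λ`-linear `π : D.X → Y` with `Function.Exact K.toX π` (kernel of `π` = image of `P`):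
  `lengthAt_X_le_lengthAt_fine` — `length X_𝔭 ≤ length Y_𝔭` at every height-one `𝔭 ∌ G₁` under
  `Irr(E[p])` (same bookkeeping as `lengthAt_X_le_lengthAt_H2`, with `(𝐇², δ)` replaced by `(Y, π)`);
  at `𝔭 = (p)`: `mu_eq_zero_of_fine_mu_eq_zero` (`Y` f.g. torsion, `μ(Y) = 0`, `G₁ ∉ (p)` ⟹ `D.mu = 0`),
  its certificate form `mu_eq_zero_of_fine_mu_eq_zero_of_certificate`, and
  `isTorsion_of_surjective` / `mu_eq_zero_of_fine_mu_eq_zero_of_surjective` (finiteness and torsion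
  of `Y` inherited from `X` along a surjective `π`).  So the cell's Theorem A may be stated on PINNED
  objects: "`Z ⊄ p·𝐇¹_Γ(T_pW)` ⟹ `μ(X₀(E/ℚ_∞)) = 0`" (`X₀ = Y.X` for `Y : W.FineSelmerDualData κ γ`),
  which is what a Kolyvagin-type argument produces (finiteness of `Sel₀(ℚ_∞, E[p^∞])[p]`, i.e. of
  `Ш¹`-type groups of `E[p] ⊗ Λ/p`), and this file converts it into `D.mu = 0`.
* ONE NAMED FACT `exists_divisibilityInputs_fineQuotient` (construction fact, review-queued, net debt
  +1): Kato's package can be chosen TOGETHER WITH a surjection `π : D.X ↠ Y.X` exact after `K.toX`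
  (the dual of `Sel₀ ⊆ Sel`).  Weaker than print (the identity of `π` is forgotten; only its kernel
  is pinned, by exactness), never stronger.

BSD is not advanced by this file; it re-targets the `μ`-obligation of route `SmallImageMuTransfer`
(items 19629/19276) from the abstract `K.H2` to the pinned `X₀(E/ℚ_∞)`.

References: K. Kato, Astérisque 295 (2004), (14.9.3) p. 240, §17.13 (17.13.1) p. 279, p. 280
[Kato2004Asterisque]; C.-H. Kim, *The structure of Selmer groups…*, Amer. J. Math. 148, §1.2.4
[Kim2022StructureSelmer]; M. F. Lim, *Notes on the fine Selmer groups*, Asian J. Math. 21 (2017) §2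
(the Poitou–Tate sequence `0 → Y_S(T/𝓛) → lim H²(G_S(L), T) → …` over a `p`-adic Lie extension)
[Lim2017FineSelmer]; tree `IwasawaAlgebra*Proofs` (`lengthAt` calculus).
-/

noncomputable section

open scoped MatrixGroups ModularForm
open Field CongruenceSubgroup
open Literature.NumberTheory.GaloisRepresentations
open Literature.NumberTheory.EllipticCurves Literature.NumberTheory.EllipticCurves.ModularForms
open Literature.NumberTheory.EllipticCurves.Kato2004.EulerSystemValues

namespace Literature.NumberTheory.EllipticCurves.Kato2004

open Module

/-! ## Theorems: `μ(X) ≤ μ(Y)` for any `π : X → Y` exact after `P → X` -/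

section Fine

variable {p : ℕ} [Fact p.Prime] {W : WeierstrassCurve ℚ} [W.IsElliptic] [W.IsGloballyMinimal]
  [ContinuousSMul ℤ_[p] (W.tateModule p)] {N : ℕ} [NeZero N] {f : CuspForm (Gamma0 N) 2}
  {κ : ZpExtension ℚ p} {γ : absoluteGaloisGroup ℚ}
  {I : IwasawaH1Data W p κ γ} {D : W.SelmerDualData κ γ}
  {Y : Type*} [AddCommGroup Y] [Module (IwasawaAlgebra p) Y]

omit [NeZero N] in
/-- **Kato (14.9.3)/(17.13.1) bookkeeping at a height-one prime `𝔭 ∌ G₁`, under `Irr(E[p])`: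
`length X(E/ℚ_∞)_𝔭 ≤ length Y_𝔭` for every `Λ`-linear `π : X → Y` whose kernel is the image of
`P → X`.**  From the package: `col(loc Z)_𝔭 ∋ s·G₁ ∉ 𝔭` (`image_zeta_localized`), so
`(Λ/col(loc Z))_𝔭 = 0`; `P/loc Z ↪ Λ/col(loc Z)` (`col` injective, 17.11); `P/loc Z → X → Y` exact
at `X` (`exact_P` and the hypothesis); hence `length X_𝔭 ≤ 0 + length Y_𝔭`.  For `Y = X₀(E/ℚ_∞)`
and `π` the dual of `Sel₀ ⊆ Sel` this is p. 280's identity read modulo `𝐇²_loc`.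
[cite: Kato2004Asterisque, (14.9.3) (p. 240), §17.13 (pp. 279–280) and Prop. 17.11 (p. 277)] -/
theorem lengthAt_X_le_lengthAt_fine (K : DivisibilityInputs W p f κ γ I D)
    (hirr : W.HasIrreducibleModPGaloisRep p) {G₁ : IwasawaAlgebra p}
    (hG₁ : iwasawaToPowerSeries p G₁ = padicLFunction f (unitRoot W p : ℚ_[p]))
    (𝔭 : PrimeSpectrum (IwasawaAlgebra p)) (h𝔭 : 𝔭.asIdeal.height = 1) (hG𝔭 : G₁ ∉ 𝔭.asIdeal)
    (π : D.X →ₗ[IwasawaAlgebra p] Y) (hπ : Function.Exact K.toX π) :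
    lengthAt (IwasawaAlgebra p) D.X 𝔭 ≤ lengthAt (IwasawaAlgebra p) Y 𝔭 := by
  obtain ⟨s, hs, hsG, -⟩ := K.image_zeta_localized hirr G₁ hG₁ 𝔭 h𝔭
  set LZ : Submodule (IwasawaAlgebra p) K.P := Submodule.map K.loc K.Z with hLZ
  set M : Ideal (IwasawaAlgebra p) := Submodule.map K.col LZ with hM
  have hM_eq : Submodule.map (K.col ∘ₗ K.loc) K.Z = M := by
    rw [hM, hLZ, Submodule.map_comp]
  have hsGM : s * G₁ ∈ M := hM_eq ▸ hsG
  have hnot : ¬ M ≤ 𝔭.asIdeal := fun hle ↦ by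
    rcases 𝔭.isPrime.mem_or_mem (hle hsGM) with h | h
    · exact hs h
    · exact hG𝔭 h
  have hΛM : lengthAt (IwasawaAlgebra p) (IwasawaAlgebra p ⧸ M) 𝔭 = 0 :=
    lengthAt_quotient_eq_zero_of_not_le hnot
  have hPLZ : lengthAt (IwasawaAlgebra p) (K.P ⧸ LZ) 𝔭 = 0 := by
    refine le_antisymm ?_ bot_le
    rw [← hΛM]
    refine lengthAt_le_of_injective (Submodule.mapQ LZ M K.col fun y hy ↦ ⟨y, hy, rfl⟩) ?_ 𝔭
    rw [← LinearMap.ker_eq_bot, Submodule.ker_mapQ, hM,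
      Submodule.comap_map_eq_of_injective K.col_injective, Submodule.mkQ_map_self]
  have hle : LZ ≤ LinearMap.ker K.toX := by
    rintro _ ⟨z, -, rfl⟩
    exact (K.exact_P (K.loc z)).mpr ⟨z, rfl⟩
  let f' : (K.P ⧸ LZ) →ₗ[IwasawaAlgebra p] D.X := LZ.liftQ K.toX hle
  have hf' : Function.Exact f' π := by
    rw [LinearMap.exact_iff, Submodule.range_liftQ]
    exact LinearMap.exact_iff.mp hπ
  calc lengthAt (IwasawaAlgebra p) D.X 𝔭
      ≤ lengthAt (IwasawaAlgebra p) (K.P ⧸ LZ) 𝔭 + lengthAt (IwasawaAlgebra p) Y 𝔭 :=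
        lengthAt_le_add_of_exact f' π hf' 𝔭
    _ = lengthAt (IwasawaAlgebra p) Y 𝔭 := by rw [hPLZ, zero_add]

omit [NeZero N] in
/-- **`μ(Y) = 0 ⟹ μ(X(E/ℚ_∞)) = 0` when `μ(L_p(E)) = 0` and `E[p]` is irreducible**, for any finitely
generated torsion `Λ`-module `Y` receiving a `Λ`-linear `π : X → Y` exact after `P → X` — the cell's
last conversion with the dual fine Selmer group `Y = X₀(E/ℚ_∞)` (pinned, `FineSelmerDualData`) in
place of the package's abstract `𝐇²`: `𝔭 = (p)` has height one (`height_augIdealP_holds`) and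
`μ = length_{(p)}` (`muInvariant_eq_toNat_lengthAt`). [cite: Kato2004Asterisque, (14.9.3) (p. 240) and §17.13 (p. 280)] -/
theorem mu_eq_zero_of_fine_mu_eq_zero (K : DivisibilityInputs W p f κ γ I D)
    (hirr : W.HasIrreducibleModPGaloisRep p) {G₁ : IwasawaAlgebra p}
    (hG₁ : iwasawaToPowerSeries p G₁ = padicLFunction f (unitRoot W p : ℚ_[p]))
    (hμL : G₁ ∉ IwasawaAlgebra.augIdealP p) [Module.Finite (IwasawaAlgebra p) Y]
    (π : D.X →ₗ[IwasawaAlgebra p] Y) (hπ : Function.Exact K.toX π)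
    (hYt : Module.IsTorsion (IwasawaAlgebra p) Y) (hY : muInvariant p Y = 0) : D.mu = 0 := by
  let 𝔭 : PrimeSpectrum (IwasawaAlgebra p) :=
    ⟨IwasawaAlgebra.augIdealP p, IwasawaAlgebra.isPrime_augIdealP_holds p⟩
  have hY' : lengthAt (IwasawaAlgebra p) Y 𝔭 = 0 := by
    have hne : lengthAt (IwasawaAlgebra p) Y 𝔭 ≠ ⊤ := lengthAt_ne_top_of_isTorsion p Y hYt 𝔭 rfl
    have hnat := muInvariant_eq_toNat_lengthAt p Y 𝔭 rfl
    rw [hY] at hnat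
    rcases ENat.toNat_eq_zero.mp hnat.symm with h | h
    · exact h
    · exact absurd h hne
  have hX : lengthAt (IwasawaAlgebra p) D.X 𝔭 = 0 :=
    le_antisymm ((lengthAt_X_le_lengthAt_fine K hirr hG₁ 𝔭
      (by exact IwasawaAlgebra.height_augIdealP_holds p) hμL π hπ).trans hY'.le) bot_le
  change muInvariant p D.X = 0
  rw [muInvariant_eq_toNat_lengthAt p D.X 𝔭 rfl, hX]
  rfl

omit [NeZero N] in
/-- The same in the certificate currency of `Rank1Residual.KatoMuTransfer`: one coefficient of
`L_p(f, α)` is a `p`-adic unit (`not_mem_augIdealP_of_norm_coeff_eq_one`).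
[cite: Kato2004Asterisque, (14.9.3) (p. 240) and §17.13 (p. 280)] -/
theorem mu_eq_zero_of_fine_mu_eq_zero_of_certificate (K : DivisibilityInputs W p f κ γ I D)
    (hirr : W.HasIrreducibleModPGaloisRep p) {G₁ : IwasawaAlgebra p}
    (hG₁ : iwasawaToPowerSeries p G₁ = padicLFunction f (unitRoot W p : ℚ_[p]))
    (hcert : ∃ n : ℕ, ‖PowerSeries.coeff n (padicLFunction f (unitRoot W p : ℚ_[p]))‖ = 1)
    [Module.Finite (IwasawaAlgebra p) Y] (π : D.X →ₗ[IwasawaAlgebra p] Y)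
    (hπ : Function.Exact K.toX π) (hYt : Module.IsTorsion (IwasawaAlgebra p) Y)
    (hY : muInvariant p Y = 0) : D.mu = 0 :=
  mu_eq_zero_of_fine_mu_eq_zero K hirr hG₁ (not_mem_augIdealP_of_norm_coeff_eq_one hG₁ hcert) π hπ
    hYt hY

/-- A quotient of a torsion `Λ`-module is torsion (used for `π : X ↠ X₀` surjective). [folklore: image of a torsion module] [cite: Kato2004Asterisque, §17.13 (p. 280)] -/
theorem isTorsion_of_surjective {X' : Type*} [AddCommGroup X'] [Module (IwasawaAlgebra p) X']
    (π : X' →ₗ[IwasawaAlgebra p] Y) (hπs : Function.Surjective π)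
    (hX : Module.IsTorsion (IwasawaAlgebra p) X') : Module.IsTorsion (IwasawaAlgebra p) Y := by
  intro y
  obtain ⟨x, rfl⟩ := hπs y
  obtain ⟨a, ha⟩ := @hX x
  exact ⟨a, by rw [Submonoid.smul_def, ← map_smul, ← Submonoid.smul_def, ha, map_zero]⟩

omit [NeZero N] in
/-- **Surjective form.**  If `π : X ↠ Y` is SURJECTIVE and exact after `P → X` (so `Y ≅ X/im P`),
`X` is a finitely generated torsion `Λ`-module (`SelmerDualData.module_finite`, Kato 17.4 (1)),
`E[p]` is irreducible, one coefficient of `L_p(E)` is a unit and `μ(Y) = 0`, then `μ(X(E/ℚ_∞)) = 0`.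
With `Y = X₀(E/ℚ_∞)` (fact `exists_divisibilityInputs_fineQuotient`) this is the closer of the
`μ`-transfer from "`μ(X₀(E/ℚ_∞)) = 0`". [cite: Kato2004Asterisque, (14.9.3) (p. 240) and §17.13 (p. 280)] -/
theorem mu_eq_zero_of_fine_mu_eq_zero_of_surjective (K : DivisibilityInputs W p f κ γ I D)
    (hirr : W.HasIrreducibleModPGaloisRep p) {G₁ : IwasawaAlgebra p}
    (hG₁ : iwasawaToPowerSeries p G₁ = padicLFunction f (unitRoot W p : ℚ_[p]))
    (hcert : ∃ n : ℕ, ‖PowerSeries.coeff n (padicLFunction f (unitRoot W p : ℚ_[p]))‖ = 1)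
    [Module.Finite (IwasawaAlgebra p) D.X] (hXt : D.IsTorsion)
    (π : D.X →ₗ[IwasawaAlgebra p] Y) (hπs : Function.Surjective π) (hπ : Function.Exact K.toX π)
    (hY : muInvariant p Y = 0) : D.mu = 0 :=
  haveI : Module.Finite (IwasawaAlgebra p) Y := Module.Finite.of_surjective π hπs
  mu_eq_zero_of_fine_mu_eq_zero_of_certificate K hirr hG₁ hcert π hπ
    (isTorsion_of_surjective π hπs hXt) hY

end Fine

/-! ## The named fact: Kato's package with the cokernel of `P → X` pinned to `X₀(E/ℚ_∞)` -/

/-- **Kato 2004, (14.9.3) (p. 240) and (17.13.1) (p. 279) for `T ≅ T_pE(−1)`, `k = 2`, together with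
the identification of the `p`-strict Selmer group over `ℚ_∞` with the fine Selmer group
`Sel₀(ℚ_∞, E[p^∞])` (Kim, AJM 148 §1.2.4): the §17.13 package EXISTS with the cokernel of
`P → X(E/ℚ_∞)` equal to the dual fine Selmer group.**  For every elliptic curve `E/ℚ` with globally
minimal model `W`, every ODD prime `p` of good ordinary reduction, the cyclotomic `ℤ_p`-extension `κ`
with topological generator `γ` matching the cyclotomic variable, every newform `f` of `W`, every
`I : IwasawaH1Data W p κ γ`, `D : W.SelmerDualData κ γ` (Kato §14.1, p. 235: "If `A` is an abelian
variety over `K`, the usual Selmer group `Sel(K, A)` of `A` coincides" with the Bloch–Kato one) and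
`Y : W.FineSelmerDualData κ γ`, there are
a package `K : DivisibilityInputs W p f κ γ I D` and a SURJECTIVE `Λ`-linear `π : D.X → Y.X` with
`Function.Exact K.toX π`.  Printed content: in (14.9.3) the map
`a : H¹(K ⊗ ℚ_p, T)/H¹_f → S(K, T*(1))^∨` is the Pontryagin dual of the localisation
`S(K, T*(1) ⊗ ℚ/ℤ) → H¹_f(K ⊗ ℚ_p, T*(1) ⊗ ℚ/ℤ)`, so `Coker(a)` is the dual of the Selmer classes
with trivial image at the primes above `p`; passing to `lim_n` over `K = ℚ(ζ_{p^n})` ((17.13.1),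
`Δ`-trivial component) and using that over `ℚ_∞` the local conditions away from `p` are "locally
trivial" (`E(ℚ_{∞,w}) ⊗ ℚ_p/ℤ_p = 0` for `w ∤ p`; Kim §1.2.4, tree `WeierstrassCurve.fineSelmerInfty`),
`Coker(P → 𝔛) = Hom(Sel₀(ℚ_∞, E[p^∞]), ℚ_p/ℤ_p) = X₀(E/ℚ_∞)`, and `π` is the dual of the inclusion
`Sel₀ ⊆ Sel`.  A CONSTRUCTION fact (weaker than print: the identity of `π` is forgotten, only its
kernel is pinned; the companion `exists_divisibilityInputs` is the same statement without `π`); with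
`mu_eq_zero_of_fine_mu_eq_zero_of_surjective` it turns "`μ(X₀(E/ℚ_∞)) = 0`" into `D.mu = 0` under
`Irr(E[p])` and a unit coefficient of `L_p(E)`.
[cite: Kato2004Asterisque, (14.9.3) (p. 240), §14.1 (p. 235), §17.13 (17.13.1) (p. 279) and p. 280; Kim2022StructureSelmer, §1.2.4; Lim2017FineSelmer, §2 (arXiv:1306.2047 p. 5)] -/
def exists_divisibilityInputs_fineQuotient : Prop :=
  ∀ (W : WeierstrassCurve ℚ) [W.IsElliptic] [W.IsGloballyMinimal] (p : ℕ) [Fact p.Prime]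
    [ContinuousSMul ℤ_[p] (W.tateModule p)] {N : ℕ} [NeZero N] (f : CuspForm (Gamma0 N) 2)
    (κ : ZpExtension ℚ p) (γ : absoluteGaloisGroup ℚ),
    p ≠ 2 → IsOrdinaryAt W p → κ.IsCyclotomic → κ.IsTopGenerator γ → IsCyclotomicVariable p γ →
    IsNewformOf W f →
    ∀ (I : IwasawaH1Data W p κ γ) (D : W.SelmerDualData κ γ) (Y : W.FineSelmerDualData κ γ),
      ∃ (K : DivisibilityInputs W p f κ γ I D) (π : D.X →ₗ[IwasawaAlgebra p] Y.X),
        Function.Surjective π ∧ Function.Exact K.toX π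

/-- Sanity check of the shapes: the fact feeds `mu_eq_zero_of_fine_mu_eq_zero_of_surjective`.
With `X` finitely generated torsion, `Irr(E[p])`, `ι G₁ = L_p`, a unit coefficient and
`μ(X₀(E/ℚ_∞)) = 0`, the pinned dual Selmer datum has `μ = 0`.
[cite: Kato2004Asterisque, (14.9.3) (p. 240) and §17.13 (p. 280)] -/
theorem mu_eq_zero_of_fineSelmerDual_mu_eq_zero (hfine : exists_divisibilityInputs_fineQuotient)
    {p : ℕ} [Fact p.Prime] {W : WeierstrassCurve ℚ} [W.IsElliptic] [W.IsGloballyMinimal]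
    [ContinuousSMul ℤ_[p] (W.tateModule p)] {N : ℕ} [NeZero N] {f : CuspForm (Gamma0 N) 2}
    {κ : ZpExtension ℚ p} {γ : absoluteGaloisGroup ℚ} (hp : p ≠ 2) (hord : IsOrdinaryAt W p)
    (hκ : κ.IsCyclotomic) (hγ : κ.IsTopGenerator γ) (hγ' : IsCyclotomicVariable p γ)
    (hf : IsNewformOf W f) (hirr : W.HasIrreducibleModPGaloisRep p) {G₁ : IwasawaAlgebra p}
    (hG₁ : iwasawaToPowerSeries p G₁ = padicLFunction f (unitRoot W p : ℚ_[p]))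
    (hcert : ∃ n : ℕ, ‖PowerSeries.coeff n (padicLFunction f (unitRoot W p : ℚ_[p]))‖ = 1)
    (I : IwasawaH1Data W p κ γ) (D : W.SelmerDualData κ γ) [Module.Finite (IwasawaAlgebra p) D.X]
    (hXt : D.IsTorsion) (Y : W.FineSelmerDualData κ γ) (hY : muInvariant p Y.X = 0) :
    D.mu = 0 := by
  obtain ⟨K, π, hπs, hπ⟩ := hfine W p f κ γ hp hord hκ hγ hγ' hf I D Y
  exact mu_eq_zero_of_fine_mu_eq_zero_of_surjective K hirr hG₁ hcert hXt π hπs hπ hY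

end Literature.NumberTheory.EllipticCurves.Kato2004

end
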